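import Literature.Analysis.FunctionSpaces.FourierSobolevNorm
import Literature.Analysis.FunctionSpaces.LittlewoodPaleyProofs
import Literature.Analysis.FunctionSpaces.PoincareWirtingerConvex
import HarnessLib

/-!
# Discharged fact of `FourierSobolevNorm`: scaling of the homogeneous Sobolev seminorm

This file discharges the named fact
`Literature.Analysis.FunctionSpaces.eHomSobolevSeminorm_comp_smul` of
`Literature/Analysis/FunctionSpaces/FourierSobolevNorm.lean` (the other facts of that file are
proved in `FourierSobolevNormProofs`, `FourierSobolevNormEmbeddingProofs`,
`FourierSobolevNormTemperedProofs`):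
for `c > 0`, `d = dim E` and any `f : E → F`,
`‖f(c·)‖_{Ḣ^s} = c^{s - d/2} ‖f‖_{Ḣ^s}`
(Bahouri–Chemin–Danchin, *Fourier Analysis and Nonlinear PDE* (2011), remark after Def. 1.31
and the scaling step in the proof of Thm. 1.38).

## Proof

The printed argument is the two-line computation
`𝓕(f(c·))(ξ) = c^{-d} 𝓕f(ξ/c)` and the change of variables `ξ = cη` in
`∫ |ξ|^{2s} |𝓕(f(c·))(ξ)|² dξ = c^{-2d} · c^{d} · c^{2s} ∫ |η|^{2s} |𝓕f(η)|² dη`.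
Since the seminorm is defined through Mathlib's `L²` Fourier transform
(`MeasureTheory.Lp.fourierTransformₗᵢ`, obtained by density from the Schwartz space), the
dilation identity for `𝓕` on `L²` is proved here by the same density argument:

* the dilation `f ↦ f(c·)` on `Lp` (volume of a finite-dimensional real inner product space),
  written `(memLp_comp_smul_fun (Lp.memLp f) hc).toLp _`, is Lipschitz hence continuous
  (`edist_toLp_comp_smul`, `continuous_toLp_comp_smul`), from the tree's change-of-variables
  lemmas `memLp_comp_smul`, `eLpNorm_comp_smul` (`LittlewoodPaleyProofs`,
  `MeasureTheory.Measure.map_addHaar_smul`);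
* `fourier_toLp_comp_smul`: `𝓕(f(c·)) = |c^d|⁻¹ (𝓕f)(c⁻¹·)` for the `L²` Fourier transform, by
  density of Schwartz functions (`SchwartzMap.denseRange_toLpCLM`, `SchwartzMap.toLp_fourier_eq`,
  `SchwartzMap.compCLMOfContinuousLinearEquiv`) from the tree's function-level identity
  `fourier_comp_smul` (`LittlewoodPaleyProofs`); a.e. form `coeFn_fourier_toLp_comp_smul`;
* `lintegral_weight_dilate`: the weighted change of variables (`lintegral_comp_smul` of
  `PoincareWirtingerConvex`);
* `eHomSobolevSeminorm_comp_smul_holds`: the assembly (off `L²` both sides are `∞`, since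
  `f ∈ L² ↔ f(c·) ∈ L²`).

## References

* H. Bahouri, J.-Y. Chemin, R. Danchin, *Fourier Analysis and Nonlinear Partial Differential
  Equations*, Grundlehren 343, Springer (2011), doi:10.1007/978-3-642-16830-7, §1.2
  (Fourier transform and dilations), Def. 1.31 and proof of Thm. 1.38.
-/

noncomputable section

open MeasureTheory MeasureTheory.Measure ENNReal FourierTransform Module SchwartzMap
open scoped NNReal RealInnerProductSpace FourierTransform

namespace Literature.Analysis.FunctionSpaces

variable {E F : Type*} [NormedAddCommGroup E] [InnerProductSpace ℝ E] [FiniteDimensional ℝ E]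
  [MeasurableSpace E] [BorelSpace E] [NormedAddCommGroup F]

/-! ### The dilation operator on `Lp` -/

section Dilation

variable {p : ℝ≥0∞}

/-- If `f ∈ L^p` (Lebesgue measure of a finite-dimensional real inner product space) and
`c ≠ 0`, then `x ↦ f (c • x)` is in `L^p`; function-level variant of the tree's
`memLp_comp_smul` (stated there for `Lp` classes). [folklore] -/
theorem memLp_comp_smul_fun {f : E → F} (hf : MemLp f p (volume : Measure E)) {c : ℝ}
    (hc : c ≠ 0) : MemLp (fun x => f (c • x)) p (volume : Measure E) :=
  MemLp.ae_eq ((quasiMeasurePreserving_smul volume hc).ae_eq_comp hf.coeFn_toLp)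
    (memLp_comp_smul (hf.toLp f) (Units.mk0 c hc))

/-- The dilation `f ↦ f(c·)` scales `L^p` distances by the constant `|c^d|^{-1/p}`
(change of variables, `eLpNorm_comp_smul`; BCD 2011, §1.2: dilations). [folklore] -/
theorem edist_toLp_comp_smul {c : ℝ} (hc : c ≠ 0) (f g : Lp F p (volume : Measure E)) :
    edist ((memLp_comp_smul_fun (Lp.memLp f) hc).toLp _)
        ((memLp_comp_smul_fun (Lp.memLp g) hc).toLp _)
      = ENNReal.ofReal |(c ^ finrank ℝ E)⁻¹| ^ (1 / p).toReal * edist f g := by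
  simp only [Lp.edist_def]
  rw [← eLpNorm_comp_smul p (⇑f - ⇑g) hc]
  apply eLpNorm_congr_ae
  filter_upwards [(memLp_comp_smul_fun (Lp.memLp f) hc).coeFn_toLp,
    (memLp_comp_smul_fun (Lp.memLp g) hc).coeFn_toLp] with x hf hg
  simp only [Pi.sub_apply, hf, hg]

/-- The dilation `f ↦ f(c·)` is continuous on `L^p` for `1 ≤ p` (it is Lipschitz with
constant `|c^d|^{-1/p}`). [folklore] -/
theorem continuous_toLp_comp_smul [Fact (1 ≤ p)] {c : ℝ} (hc : c ≠ 0) :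
    Continuous fun f : Lp F p (volume : Measure E) =>
      (memLp_comp_smul_fun (Lp.memLp f) hc).toLp _ := by
  set K := ENNReal.ofReal |(c ^ finrank ℝ E)⁻¹| ^ (1 / p).toReal with hK
  have hK' : K ≠ ∞ := ENNReal.rpow_ne_top_of_nonneg (by positivity) ENNReal.ofReal_ne_top
  apply LipschitzWith.continuous (K := K.toNNReal)
  intro f g
  rw [edist_toLp_comp_smul hc, ENNReal.coe_toNNReal hK']

end Dilation

/-! ### The `L²` Fourier transform and dilations -/

section Fourier

variable [InnerProductSpace ℂ F] [CompleteSpace F]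

/-- Dilation identity for the `L²` Fourier transform (Plancherel extension): for `c ≠ 0` and
`f ∈ L²(E; F)`, `𝓕(f(c·)) = |c^d|⁻¹ · (𝓕f)(c⁻¹ ·)` in `L²`, `d = dim E`
(BCD 2011, §1.2, behaviour of `𝓕` under dilations, extended from `𝓢` to `L²`). Proved from
the function-level identity on the Schwartz space (`fourier_comp_smul`,
`SchwartzMap.toLp_fourier_eq`) by density of Schwartz functions in `L²` and continuity of both
sides. [folklore] -/
theorem fourier_toLp_comp_smul {c : ℝ} (hc : c ≠ 0) (f : Lp F 2 (volume : Measure E)) :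
    (𝓕 ((memLp_comp_smul_fun (Lp.memLp f) hc).toLp _) : Lp F 2 (volume : Measure E))
      = (|(c ^ finrank ℝ E)⁻¹| : ℝ) •
        (memLp_comp_smul_fun (Lp.memLp (𝓕 f : Lp F 2 (volume : Measure E)))
          (inv_ne_zero hc)).toLp _ := by
  refine DenseRange.induction_on
    (p := fun f : Lp F 2 (volume : Measure E) =>
      (𝓕 ((memLp_comp_smul_fun (Lp.memLp f) hc).toLp _) : Lp F 2 (volume : Measure E))
        = (|(c ^ finrank ℝ E)⁻¹| : ℝ) •
          (memLp_comp_smul_fun (Lp.memLp (𝓕 f : Lp F 2 (volume : Measure E)))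
            (inv_ne_zero hc)).toLp _)
    (SchwartzMap.denseRange_toLpCLM (E := E) (F := F) (p := 2) (μ := volume)
      ENNReal.ofNat_ne_top) f ?_ ?_
  · have h1 : Continuous fun f : Lp F 2 (volume : Measure E) =>
        (memLp_comp_smul_fun (Lp.memLp (𝓕 f : Lp F 2 (volume : Measure E)))
          (inv_ne_zero hc)).toLp _ :=
      (continuous_toLp_comp_smul (p := 2) (inv_ne_zero hc)).comp continuous_fourier
    exact isClosed_eq (continuous_fourier.comp (continuous_toLp_comp_smul (p := 2) hc))
      (h1.const_smul (|(c ^ finrank ℝ E)⁻¹| : ℝ))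
  · intro φ
    simp only [SchwartzMap.toLpCLM_apply]
    -- `ψ = φ(c ·)` as a Schwartz function
    set ψ : 𝓢(E, F) := SchwartzMap.compCLMOfContinuousLinearEquiv ℂ
      (ContinuousLinearEquiv.smulLeft (Units.mk0 c hc) : E ≃L[ℝ] E) φ with hψdef
    have hψ : ∀ x, ψ x = φ (c • x) := fun x => rfl
    have h1 : (memLp_comp_smul_fun (Lp.memLp (φ.toLp 2 (μ := (volume : Measure E)))) hc).toLp _
        = ψ.toLp 2 := by
      apply Lp.ext
      filter_upwards [(memLp_comp_smul_fun (Lp.memLp (φ.toLp 2 (μ := (volume : Measure E))))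
          hc).coeFn_toLp, ψ.coeFn_toLp 2 (volume),
        (quasiMeasurePreserving_smul volume hc).ae_eq_comp (φ.coeFn_toLp 2 (volume))]
        with x h1 h2 h3
      rw [h1, h2, hψ]; exact h3
    rw [h1, SchwartzMap.toLp_fourier_eq]
    apply Lp.ext
    filter_upwards [(𝓕 ψ).coeFn_toLp 2 (volume),
      Lp.coeFn_smul (|(c ^ finrank ℝ E)⁻¹| : ℝ)
        ((memLp_comp_smul_fun (Lp.memLp (𝓕 (φ.toLp 2 (μ := (volume : Measure E))) :
          Lp F 2 (volume : Measure E))) (inv_ne_zero hc)).toLp _),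
      (memLp_comp_smul_fun (Lp.memLp (𝓕 (φ.toLp 2 (μ := (volume : Measure E))) :
          Lp F 2 (volume : Measure E))) (inv_ne_zero hc)).coeFn_toLp,
      (quasiMeasurePreserving_smul volume (inv_ne_zero hc)).ae_eq_comp
        ((𝓕 φ).coeFn_toLp 2 (volume))] with ξ h1 h2 h3 h4
    rw [h1, h2, Pi.smul_apply, h3, SchwartzMap.toLp_fourier_eq]
    simp only [Function.comp_apply] at h4
    rw [h4, SchwartzMap.fourier_coe, SchwartzMap.fourier_coe,
      show (ψ : E → F) = fun x => φ (c • x) from funext hψ, fourier_comp_smul _ hc]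

/-- A.e. form of the `L²` dilation identity for functions: if `f ∈ L²(E; F)` and `c ≠ 0`, the
`L²` Fourier transform of (the class of) `x ↦ f (c • x)` is represented by
`ξ ↦ |c^d|⁻¹ • (𝓕 f)(c⁻¹ • ξ)` (BCD 2011, §1.2). [folklore] -/
theorem coeFn_fourier_toLp_comp_smul {f : E → F} (hf : MemLp f 2 (volume : Measure E)) {c : ℝ}
    (hc : c ≠ 0) :
    ⇑(𝓕 ((memLp_comp_smul_fun hf hc).toLp _) : Lp F 2 (volume : Measure E)) =ᵐ[volume]
      fun ξ => |(c ^ finrank ℝ E)⁻¹| • (𝓕 (hf.toLp f) : Lp F 2 (volume : Measure E))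
        (c⁻¹ • ξ) := by
  have hLp : (memLp_comp_smul_fun hf hc).toLp _
      = (memLp_comp_smul_fun (Lp.memLp (hf.toLp f)) hc).toLp _ := by
    apply Lp.ext
    filter_upwards [(memLp_comp_smul_fun hf hc).coeFn_toLp,
      (memLp_comp_smul_fun (Lp.memLp (hf.toLp f)) hc).coeFn_toLp,
      (quasiMeasurePreserving_smul volume hc).ae_eq_comp hf.coeFn_toLp] with x h1 h2 h3
    simp only [Function.comp_apply] at h3
    rw [h1, h2, h3]
  rw [hLp, fourier_toLp_comp_smul hc]
  filter_upwards [Lp.coeFn_smul (|(c ^ finrank ℝ E)⁻¹| : ℝ)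
      ((memLp_comp_smul_fun (Lp.memLp (𝓕 (hf.toLp f) : Lp F 2 (volume : Measure E)))
        (inv_ne_zero hc)).toLp _),
    (memLp_comp_smul_fun (Lp.memLp (𝓕 (hf.toLp f) : Lp F 2 (volume : Measure E)))
        (inv_ne_zero hc)).coeFn_toLp] with ξ h1 h2
  rw [h1, Pi.smul_apply, h2]

omit [CompleteSpace F] in
/-- Weighted change of variables behind the scaling law: for any `Φ : E → F`, `c > 0`,
`∫ ‖ξ‖^{2s} ‖c^{-d} Φ(ξ/c)‖² dξ = c^{2s-d} ∫ ‖η‖^{2s} ‖Φ(η)‖² dη` (as `ℝ≥0∞`-valued integrals,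
`d = dim E`; BCD 2011, proof of Thm. 1.38). [folklore] -/
theorem lintegral_weight_dilate (Φ : E → F) (s : ℝ) {c : ℝ} (hc : 0 < c) :
    ∫⁻ ξ, ‖ξ‖ₑ ^ (2 * s) * ‖|(c ^ finrank ℝ E)⁻¹| • Φ (c⁻¹ • ξ)‖ₑ ^ 2
      = ENNReal.ofReal c ^ (2 * s - finrank ℝ E) * ∫⁻ η, ‖η‖ₑ ^ (2 * s) * ‖Φ η‖ₑ ^ 2 := by
  set d := finrank ℝ E with hd
  set G : E → ℝ≥0∞ := fun η => ‖c • η‖ₑ ^ (2 * s) * ‖|(c ^ d)⁻¹| • Φ η‖ₑ ^ 2 with hG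
  have h1 : (fun ξ : E => ‖ξ‖ₑ ^ (2 * s) * ‖|(c ^ d)⁻¹| • Φ (c⁻¹ • ξ)‖ₑ ^ 2)
      = fun ξ => G (c⁻¹ • ξ) := by
    ext ξ; simp only [hG, smul_inv_smul₀ hc.ne']
  rw [h1, lintegral_comp_smul volume G (inv_ne_zero hc.ne')]
  have hC0 : ENNReal.ofReal c ≠ 0 := (ENNReal.ofReal_pos.2 hc).ne'
  have hCtop : ENNReal.ofReal c ≠ ∞ := ENNReal.ofReal_ne_top
  have hD0 : ENNReal.ofReal c ^ d ≠ 0 := pow_ne_zero _ hC0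
  have hDtop : ENNReal.ofReal c ^ d ≠ ∞ := ENNReal.pow_ne_top hCtop
  have hk : ‖|(c ^ d)⁻¹|‖ₑ = (ENNReal.ofReal c ^ d)⁻¹ := by
    rw [Real.enorm_eq_ofReal (abs_nonneg _), abs_of_pos (inv_pos.2 (pow_pos hc d)),
      ENNReal.ofReal_inv_of_pos (pow_pos hc d), ENNReal.ofReal_pow hc.le]
  have hc' : ‖c‖ₑ = ENNReal.ofReal c := Real.enorm_eq_ofReal hc.le
  have hjac : ENNReal.ofReal |((c⁻¹) ^ d)⁻¹| = ENNReal.ofReal c ^ d := by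
    rw [inv_pow, inv_inv, abs_of_pos (pow_pos hc d), ENNReal.ofReal_pow hc.le]
  have hG' : ∀ η, G η = (ENNReal.ofReal c ^ (2 * s) * (ENNReal.ofReal c ^ d)⁻¹ ^ 2)
      * (‖η‖ₑ ^ (2 * s) * ‖Φ η‖ₑ ^ 2) := by
    intro η
    simp only [hG, enorm_smul, hk, hc']
    rw [ENNReal.mul_rpow_of_ne_top hCtop enorm_ne_top, mul_pow]
    ring
  simp_rw [hG']
  rw [lintegral_const_mul' _ _ (ENNReal.mul_ne_top (ENNReal.rpow_ne_top_of_nonneg'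
      (pos_iff_ne_zero.2 hC0) hCtop) (ENNReal.pow_ne_top (ENNReal.inv_ne_top.2 hD0))), hjac,
    ENNReal.rpow_sub _ _ hC0 hCtop, ENNReal.rpow_natCast, div_eq_mul_inv]
  rw [show ENNReal.ofReal c ^ d * (ENNReal.ofReal c ^ (2 * s) * (ENNReal.ofReal c ^ d)⁻¹ ^ 2
      * ∫⁻ η, ‖η‖ₑ ^ (2 * s) * ‖Φ η‖ₑ ^ 2)
      = (ENNReal.ofReal c ^ d * (ENNReal.ofReal c ^ d)⁻¹)
        * (ENNReal.ofReal c ^ (2 * s) * (ENNReal.ofReal c ^ d)⁻¹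
          * ∫⁻ η, ‖η‖ₑ ^ (2 * s) * ‖Φ η‖ₑ ^ 2) by ring,
    ENNReal.mul_inv_cancel hD0 hDtop, one_mul]

/-! ### Assembly -/

/-- **Scaling of the homogeneous Sobolev seminorm** (discharge of the named fact
`eHomSobolevSeminorm_comp_smul`): for `c > 0`, `d = dim E` and every `f : E → F`,
`‖f(c·)‖_{Ḣ^s} = c^{s - d/2} ‖f‖_{Ḣ^s}`; if `f ∉ L²` then `f(c·) ∉ L²` and both sides are `∞`
(Bahouri–Chemin–Danchin 2011, remark after Def. 1.31; the scaling step in the proof of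
Thm. 1.38). [cite: BahouriCheminDanchin2011, remark after Def. 1.31 / proof of Thm. 1.38] -/
theorem eHomSobolevSeminorm_comp_smul_holds :
    eHomSobolevSeminorm_comp_smul (E := E) (F := F) := by
  intro s f c hc
  by_cases hf : MemLp f 2 (volume : Measure E)
  · have hg : MemLp (fun x => f (c • x)) 2 (volume : Measure E) := memLp_comp_smul_fun hf hc.ne'
    rw [Function.eHomSobolevSeminorm, Function.eHomSobolevSeminorm, dif_pos hg, dif_pos hf]
    -- the Fourier transform of `f(c ·)` is the rescaled dilate of `𝓕 f`
    have hF := coeFn_fourier_toLp_comp_smul hf hc.ne'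
    -- change of variables in the weighted integral
    unfold eHomSobolevSeminorm
    have hI : ∫⁻ ξ, ‖ξ‖ₑ ^ (2 * s)
          * ‖(𝓕 (hg.toLp _) : Lp F 2 (volume : Measure E)) ξ‖ₑ ^ 2
        = ENNReal.ofReal c ^ (2 * s - finrank ℝ E)
          * ∫⁻ η, ‖η‖ₑ ^ (2 * s)
            * ‖(𝓕 (hf.toLp f) : Lp F 2 (volume : Measure E)) η‖ₑ ^ 2 := by
      calc ∫⁻ ξ, ‖ξ‖ₑ ^ (2 * s)
            * ‖(𝓕 (hg.toLp _) : Lp F 2 (volume : Measure E)) ξ‖ₑ ^ 2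
          = ∫⁻ ξ, ‖ξ‖ₑ ^ (2 * s) * ‖|(c ^ finrank ℝ E)⁻¹|
              • (𝓕 (hf.toLp f) : Lp F 2 (volume : Measure E)) (c⁻¹ • ξ)‖ₑ ^ 2 := by
            apply lintegral_congr_ae
            filter_upwards [hF] with ξ hξ
            rw [hξ]
        _ = _ := lintegral_weight_dilate _ s hc
    rw [hI, ENNReal.mul_rpow_of_nonneg _ _ (by norm_num : (0 : ℝ) ≤ 1 / 2), ← ENNReal.rpow_mul,
      ENNReal.ofReal_rpow_of_pos hc,
      show (2 * s - (finrank ℝ E : ℝ)) * (1 / 2) = s - (finrank ℝ E : ℝ) / 2 by ring]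
  · -- off `L²`: `f ∉ L²` iff `f(c ·) ∉ L²`, and both sides are `∞`
    have hg : ¬ MemLp (fun x => f (c • x)) 2 (volume : Measure E) := by
      intro h
      apply hf
      simpa [smul_smul, mul_inv_cancel₀ hc.ne'] using memLp_comp_smul_fun h (inv_ne_zero hc.ne')
    rw [Function.eHomSobolevSeminorm, Function.eHomSobolevSeminorm, dif_neg hg, dif_neg hf,
      ENNReal.mul_top]
    exact (ENNReal.ofReal_pos.2 (Real.rpow_pos_of_pos hc _)).ne'

end Fourier

end Literature.Analysis.FunctionSpaces
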